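import Summits.Ventures.PercRepro.S1CoreLPCells

/-!
# PercRepro — THE `(9, 6)` CELL UNDER «LINES ≤ 3 POINTS»: EVERY SIMPLE COLOOP-FREE MATROID OF RANK `9` ON `15`
POINTS WHOSE LINES HAVE AT MOST `3` POINTS SATISFIES THE `(9, 4)` BODY (p2, gen 29; SUBCLAIM-S1 §6.10 (xviii))

The coloop/closure LP of the cell `(9, 6)`: the partition lower bounds `C(15, k) ≤ Σ_r m[k, r]`, the zero classes
(`m[k, 2] = 0` for `k ≥ 4` by the line bound; `m[k, r] = 0` for `k > r + 5`, `3 ≤ r < 9`, by the coloop-free flat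
bound), the upward instances with `b − 1` coloops (`k = b + 1`) or `b − 2` coloops (`k ≥ b + 2`, nullity `≥ 2` under
the line bound) and the closure instances with `3` (`k = b`) or `k − b + 4` (`k ≥ b + 1`) non-coloops imply
`Φ(9, 4)·#U ≤ #Y` by linear arithmetic, for EVERY finite matroid of rank `9` on `15` points with all pairs of rank
`2`, no coloops and no line of `4` points — connected or not. The line bound is one of the `e`-free core facts of the
cell (`RankLevelSetLocalSparse`).

* **`rls_nine_four_of_fifteen_of_lines`**.
Axioms: standard.
-/

open scoped Matroid

namespace PercRepro

namespace S1

open Set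

variable {α : Type}

/-- **THE `(9, 6)` CELL UNDER «LINES ≤ 3 POINTS»**: every finite matroid of rank `9` on `15` points with all pairs
of rank `2`, no coloops and every rank-`2` set of at most `3` points satisfies the `(9, 4)` body `ThmN.RLS M 9 4`. -/
theorem rls_nine_four_of_fifteen_of_lines (M : Matroid α) [M.Finite] (hM : M.eRank = ((9 : ℕ) : ℕ∞))
    (hE : M.E.ncard = 15) (hcol : M.coloops = ∅) (hpairs : ∀ e ∈ M.E, ∀ f ∈ M.E, e ≠ f → M.eRk {e, f} = 2)
    (hlines : ∀ L ⊆ M.E, M.eRk L = 2 → L.ncard ≤ 3) :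
    ThmN.RLS M 9 4 := by
  have hE2 : 2 ≤ M.E.ncard := by rw [hE]; norm_num
  have hIcc : Finset.Icc 2 9 = {2, 3, 4, 5, 6, 7, 8, 9} := by decide
  -- the `U`-bound
  have hU := ncard_U_add_le (M := M) hM (by norm_num) hE (by norm_num) (show 15 = 9 + 6 by norm_num)
  rw [show Finset.Icc 5 6 = {5, 6} from by decide, Finset.sum_insert (by decide), Finset.sum_singleton, show Nat.choose 15 4 = 1365 by decide,
    show 15 - 4 = 11 from rfl, show 9 - 1 = 8 from rfl] at hU
  have hL := sum_ncard_rkSets_le_ncard_lowRankSets (M := M) 11 8 {2, 3, 4, 5, 6, 7, 8} (by decide)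
  rw [Finset.sum_insert (by decide), Finset.sum_insert (by decide), Finset.sum_insert (by decide), Finset.sum_insert (by decide), Finset.sum_insert (by decide), Finset.sum_insert (by decide), Finset.sum_singleton] at hL
  -- the `Y`-sum
  have hY := ncard_Y_eq_sum (M := M) 4 9
  rw [show Finset.Ioo 4 9 = {5, 6, 7, 8} from by decide, Finset.sum_insert (by decide), Finset.sum_insert (by decide), Finset.sum_insert (by decide), Finset.sum_singleton] at hY
  have hY5 := sum_ncard_rkSets_le_ncard_rankSet (M := M) 5 {5, 6, 7, 8, 9, 10, 11, 12, 13, 14, 15}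
  rw [Finset.sum_insert (by decide), Finset.sum_insert (by decide), Finset.sum_insert (by decide), Finset.sum_insert (by decide), Finset.sum_insert (by decide), Finset.sum_insert (by decide), Finset.sum_insert (by decide), Finset.sum_insert (by decide), Finset.sum_insert (by decide), Finset.sum_insert (by decide), Finset.sum_singleton] at hY5
  have hY6 := sum_ncard_rkSets_le_ncard_rankSet (M := M) 6 {6, 7, 8, 9, 10, 11, 12, 13, 14, 15}
  rw [Finset.sum_insert (by decide), Finset.sum_insert (by decide), Finset.sum_insert (by decide), Finset.sum_insert (by decide), Finset.sum_insert (by decide), Finset.sum_insert (by decide), Finset.sum_insert (by decide), Finset.sum_insert (by decide), Finset.sum_insert (by decide), Finset.sum_singleton] at hY6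
  have hY7 := sum_ncard_rkSets_le_ncard_rankSet (M := M) 7 {7, 8, 9, 10, 11, 12, 13, 14, 15}
  rw [Finset.sum_insert (by decide), Finset.sum_insert (by decide), Finset.sum_insert (by decide), Finset.sum_insert (by decide), Finset.sum_insert (by decide), Finset.sum_insert (by decide), Finset.sum_insert (by decide), Finset.sum_insert (by decide), Finset.sum_singleton] at hY7
  have hY8 := sum_ncard_rkSets_le_ncard_rankSet (M := M) 8 {8, 9, 10, 11, 12, 13, 14, 15}
  rw [Finset.sum_insert (by decide), Finset.sum_insert (by decide), Finset.sum_insert (by decide), Finset.sum_insert (by decide), Finset.sum_insert (by decide), Finset.sum_insert (by decide), Finset.sum_insert (by decide), Finset.sum_singleton] at hY8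
  -- the partition lower bounds
  have hP5 := choose_le_sum_ncard_rkSets hM hpairs (k := 5) (by norm_num)
  rw [hE, show Nat.choose 15 5 = 3003 by decide, hIcc, Finset.sum_insert (by decide), Finset.sum_insert (by decide), Finset.sum_insert (by decide), Finset.sum_insert (by decide), Finset.sum_insert (by decide), Finset.sum_insert (by decide), Finset.sum_insert (by decide), Finset.sum_singleton] at hP5
  have hP6 := choose_le_sum_ncard_rkSets hM hpairs (k := 6) (by norm_num)
  rw [hE, show Nat.choose 15 6 = 5005 by decide, hIcc, Finset.sum_insert (by decide), Finset.sum_insert (by decide), Finset.sum_insert (by decide), Finset.sum_insert (by decide), Finset.sum_insert (by decide), Finset.sum_insert (by decide), Finset.sum_insert (by decide), Finset.sum_singleton] at hP6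
  have hP7 := choose_le_sum_ncard_rkSets hM hpairs (k := 7) (by norm_num)
  rw [hE, show Nat.choose 15 7 = 6435 by decide, hIcc, Finset.sum_insert (by decide), Finset.sum_insert (by decide), Finset.sum_insert (by decide), Finset.sum_insert (by decide), Finset.sum_insert (by decide), Finset.sum_insert (by decide), Finset.sum_insert (by decide), Finset.sum_singleton] at hP7
  have hP8 := choose_le_sum_ncard_rkSets hM hpairs (k := 8) (by norm_num)
  rw [hE, show Nat.choose 15 8 = 6435 by decide, hIcc, Finset.sum_insert (by decide), Finset.sum_insert (by decide), Finset.sum_insert (by decide), Finset.sum_insert (by decide), Finset.sum_insert (by decide), Finset.sum_insert (by decide), Finset.sum_insert (by decide), Finset.sum_singleton] at hP8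
  -- the zero classes
  have hz_2_3 : (rkSets M 2 3).ncard = 0 := by rw [rkSets_eq_empty_of_lt (by norm_num)]; exact ncard_empty _
  have hz_2_4 : (rkSets M 2 4).ncard = 0 := by rw [rkSets_eq_empty_of_lt (by norm_num)]; exact ncard_empty _
  have hz_2_5 : (rkSets M 2 5).ncard = 0 := by rw [rkSets_eq_empty_of_lt (by norm_num)]; exact ncard_empty _
  have hz_2_6 : (rkSets M 2 6).ncard = 0 := by rw [rkSets_eq_empty_of_lt (by norm_num)]; exact ncard_empty _
  have hz_2_7 : (rkSets M 2 7).ncard = 0 := by rw [rkSets_eq_empty_of_lt (by norm_num)]; exact ncard_empty _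
  have hz_2_8 : (rkSets M 2 8).ncard = 0 := by rw [rkSets_eq_empty_of_lt (by norm_num)]; exact ncard_empty _
  have hz_2_9 : (rkSets M 2 9).ncard = 0 := by rw [rkSets_eq_empty_of_lt (by norm_num)]; exact ncard_empty _
  have hz_3_4 : (rkSets M 3 4).ncard = 0 := by rw [rkSets_eq_empty_of_lt (by norm_num)]; exact ncard_empty _
  have hz_3_5 : (rkSets M 3 5).ncard = 0 := by rw [rkSets_eq_empty_of_lt (by norm_num)]; exact ncard_empty _
  have hz_3_6 : (rkSets M 3 6).ncard = 0 := by rw [rkSets_eq_empty_of_lt (by norm_num)]; exact ncard_empty _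
  have hz_3_7 : (rkSets M 3 7).ncard = 0 := by rw [rkSets_eq_empty_of_lt (by norm_num)]; exact ncard_empty _
  have hz_3_8 : (rkSets M 3 8).ncard = 0 := by rw [rkSets_eq_empty_of_lt (by norm_num)]; exact ncard_empty _
  have hz_3_9 : (rkSets M 3 9).ncard = 0 := by rw [rkSets_eq_empty_of_lt (by norm_num)]; exact ncard_empty _
  have hz_4_2 : (rkSets M 4 2).ncard = 0 := by rw [rkSets_eq_empty_of_lines hlines (by norm_num)]; exact ncard_empty _
  have hz_4_5 : (rkSets M 4 5).ncard = 0 := by rw [rkSets_eq_empty_of_lt (by norm_num)]; exact ncard_empty _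
  have hz_4_6 : (rkSets M 4 6).ncard = 0 := by rw [rkSets_eq_empty_of_lt (by norm_num)]; exact ncard_empty _
  have hz_4_7 : (rkSets M 4 7).ncard = 0 := by rw [rkSets_eq_empty_of_lt (by norm_num)]; exact ncard_empty _
  have hz_4_8 : (rkSets M 4 8).ncard = 0 := by rw [rkSets_eq_empty_of_lt (by norm_num)]; exact ncard_empty _
  have hz_4_9 : (rkSets M 4 9).ncard = 0 := by rw [rkSets_eq_empty_of_lt (by norm_num)]; exact ncard_empty _
  have hz_5_2 : (rkSets M 5 2).ncard = 0 := by rw [rkSets_eq_empty_of_lines hlines (by norm_num)]; exact ncard_empty _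
  have hz_5_6 : (rkSets M 5 6).ncard = 0 := by rw [rkSets_eq_empty_of_lt (by norm_num)]; exact ncard_empty _
  have hz_5_7 : (rkSets M 5 7).ncard = 0 := by rw [rkSets_eq_empty_of_lt (by norm_num)]; exact ncard_empty _
  have hz_5_8 : (rkSets M 5 8).ncard = 0 := by rw [rkSets_eq_empty_of_lt (by norm_num)]; exact ncard_empty _
  have hz_5_9 : (rkSets M 5 9).ncard = 0 := by rw [rkSets_eq_empty_of_lt (by norm_num)]; exact ncard_empty _
  have hz_6_2 : (rkSets M 6 2).ncard = 0 := by rw [rkSets_eq_empty_of_lines hlines (by norm_num)]; exact ncard_empty _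
  have hz_6_7 : (rkSets M 6 7).ncard = 0 := by rw [rkSets_eq_empty_of_lt (by norm_num)]; exact ncard_empty _
  have hz_6_8 : (rkSets M 6 8).ncard = 0 := by rw [rkSets_eq_empty_of_lt (by norm_num)]; exact ncard_empty _
  have hz_6_9 : (rkSets M 6 9).ncard = 0 := by rw [rkSets_eq_empty_of_lt (by norm_num)]; exact ncard_empty _
  have hz_7_2 : (rkSets M 7 2).ncard = 0 := by rw [rkSets_eq_empty_of_lines hlines (by norm_num)]; exact ncard_empty _
  have hz_7_8 : (rkSets M 7 8).ncard = 0 := by rw [rkSets_eq_empty_of_lt (by norm_num)]; exact ncard_empty _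
  have hz_7_9 : (rkSets M 7 9).ncard = 0 := by rw [rkSets_eq_empty_of_lt (by norm_num)]; exact ncard_empty _
  have hz_8_2 : (rkSets M 8 2).ncard = 0 := by rw [rkSets_eq_empty_of_lines hlines (by norm_num)]; exact ncard_empty _
  have hz_8_9 : (rkSets M 8 9).ncard = 0 := by rw [rkSets_eq_empty_of_lt (by norm_num)]; exact ncard_empty _
  have hz_9_2 : (rkSets M 9 2).ncard = 0 := by rw [rkSets_eq_empty_of_lines hlines (by norm_num)]; exact ncard_empty _
  have hz_9_3 : (rkSets M 9 3).ncard = 0 := by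
    rw [rkSets_eq_empty_of_coloops hM hcol hE (by norm_num) (by norm_num)]; exact ncard_empty _
  have hz_10_2 : (rkSets M 10 2).ncard = 0 := by rw [rkSets_eq_empty_of_lines hlines (by norm_num)]; exact ncard_empty _
  have hz_10_3 : (rkSets M 10 3).ncard = 0 := by
    rw [rkSets_eq_empty_of_coloops hM hcol hE (by norm_num) (by norm_num)]; exact ncard_empty _
  have hz_10_4 : (rkSets M 10 4).ncard = 0 := by
    rw [rkSets_eq_empty_of_coloops hM hcol hE (by norm_num) (by norm_num)]; exact ncard_empty _
  have hz_11_2 : (rkSets M 11 2).ncard = 0 := by rw [rkSets_eq_empty_of_lines hlines (by norm_num)]; exact ncard_empty _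
  have hz_11_3 : (rkSets M 11 3).ncard = 0 := by
    rw [rkSets_eq_empty_of_coloops hM hcol hE (by norm_num) (by norm_num)]; exact ncard_empty _
  have hz_11_4 : (rkSets M 11 4).ncard = 0 := by
    rw [rkSets_eq_empty_of_coloops hM hcol hE (by norm_num) (by norm_num)]; exact ncard_empty _
  have hz_11_5 : (rkSets M 11 5).ncard = 0 := by
    rw [rkSets_eq_empty_of_coloops hM hcol hE (by norm_num) (by norm_num)]; exact ncard_empty _
  have hz_12_2 : (rkSets M 12 2).ncard = 0 := by rw [rkSets_eq_empty_of_lines hlines (by norm_num)]; exact ncard_empty _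
  have hz_12_3 : (rkSets M 12 3).ncard = 0 := by
    rw [rkSets_eq_empty_of_coloops hM hcol hE (by norm_num) (by norm_num)]; exact ncard_empty _
  have hz_12_4 : (rkSets M 12 4).ncard = 0 := by
    rw [rkSets_eq_empty_of_coloops hM hcol hE (by norm_num) (by norm_num)]; exact ncard_empty _
  have hz_12_5 : (rkSets M 12 5).ncard = 0 := by
    rw [rkSets_eq_empty_of_coloops hM hcol hE (by norm_num) (by norm_num)]; exact ncard_empty _
  have hz_12_6 : (rkSets M 12 6).ncard = 0 := by
    rw [rkSets_eq_empty_of_coloops hM hcol hE (by norm_num) (by norm_num)]; exact ncard_empty _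
  have hz_13_2 : (rkSets M 13 2).ncard = 0 := by rw [rkSets_eq_empty_of_lines hlines (by norm_num)]; exact ncard_empty _
  have hz_13_3 : (rkSets M 13 3).ncard = 0 := by
    rw [rkSets_eq_empty_of_coloops hM hcol hE (by norm_num) (by norm_num)]; exact ncard_empty _
  have hz_13_4 : (rkSets M 13 4).ncard = 0 := by
    rw [rkSets_eq_empty_of_coloops hM hcol hE (by norm_num) (by norm_num)]; exact ncard_empty _
  have hz_13_5 : (rkSets M 13 5).ncard = 0 := by
    rw [rkSets_eq_empty_of_coloops hM hcol hE (by norm_num) (by norm_num)]; exact ncard_empty _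
  have hz_13_6 : (rkSets M 13 6).ncard = 0 := by
    rw [rkSets_eq_empty_of_coloops hM hcol hE (by norm_num) (by norm_num)]; exact ncard_empty _
  have hz_13_7 : (rkSets M 13 7).ncard = 0 := by
    rw [rkSets_eq_empty_of_coloops hM hcol hE (by norm_num) (by norm_num)]; exact ncard_empty _
  have hz_14_2 : (rkSets M 14 2).ncard = 0 := by rw [rkSets_eq_empty_of_lines hlines (by norm_num)]; exact ncard_empty _
  have hz_14_3 : (rkSets M 14 3).ncard = 0 := by
    rw [rkSets_eq_empty_of_coloops hM hcol hE (by norm_num) (by norm_num)]; exact ncard_empty _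
  have hz_14_4 : (rkSets M 14 4).ncard = 0 := by
    rw [rkSets_eq_empty_of_coloops hM hcol hE (by norm_num) (by norm_num)]; exact ncard_empty _
  have hz_14_5 : (rkSets M 14 5).ncard = 0 := by
    rw [rkSets_eq_empty_of_coloops hM hcol hE (by norm_num) (by norm_num)]; exact ncard_empty _
  have hz_14_6 : (rkSets M 14 6).ncard = 0 := by
    rw [rkSets_eq_empty_of_coloops hM hcol hE (by norm_num) (by norm_num)]; exact ncard_empty _
  have hz_14_7 : (rkSets M 14 7).ncard = 0 := by
    rw [rkSets_eq_empty_of_coloops hM hcol hE (by norm_num) (by norm_num)]; exact ncard_empty _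
  have hz_14_8 : (rkSets M 14 8).ncard = 0 := by
    rw [rkSets_eq_empty_of_coloops hM hcol hE (by norm_num) (by norm_num)]; exact ncard_empty _
  have hz_15_2 : (rkSets M 15 2).ncard = 0 := by rw [rkSets_eq_empty_of_lines hlines (by norm_num)]; exact ncard_empty _
  have hz_15_3 : (rkSets M 15 3).ncard = 0 := by
    rw [rkSets_eq_empty_of_coloops hM hcol hE (by norm_num) (by norm_num)]; exact ncard_empty _
  have hz_15_4 : (rkSets M 15 4).ncard = 0 := by
    rw [rkSets_eq_empty_of_coloops hM hcol hE (by norm_num) (by norm_num)]; exact ncard_empty _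
  have hz_15_5 : (rkSets M 15 5).ncard = 0 := by
    rw [rkSets_eq_empty_of_coloops hM hcol hE (by norm_num) (by norm_num)]; exact ncard_empty _
  have hz_15_6 : (rkSets M 15 6).ncard = 0 := by
    rw [rkSets_eq_empty_of_coloops hM hcol hE (by norm_num) (by norm_num)]; exact ncard_empty _
  have hz_15_7 : (rkSets M 15 7).ncard = 0 := by
    rw [rkSets_eq_empty_of_coloops hM hcol hE (by norm_num) (by norm_num)]; exact ncard_empty _
  have hz_15_8 : (rkSets M 15 8).ncard = 0 := by
    rw [rkSets_eq_empty_of_coloops hM hcol hE (by norm_num) (by norm_num)]; exact ncard_empty _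
  -- the upward and closure instances
  have hUP_5_3 := up_instance_lines hpairs hlines hE2 5 3 (by norm_num)
  rw [hE] at hUP_5_3
  norm_num at hUP_5_3
  have hUP_5_4 := up_instance hpairs hE2 5 4 (by norm_num)
  rw [hE] at hUP_5_4
  norm_num at hUP_5_4
  have hUP_6_3 := up_instance_lines hpairs hlines hE2 6 3 (by norm_num)
  rw [hE] at hUP_6_3
  norm_num at hUP_6_3
  have hUP_6_4 := up_instance_lines hpairs hlines hE2 6 4 (by norm_num)
  rw [hE] at hUP_6_4
  norm_num at hUP_6_4
  have hUP_6_5 := up_instance hpairs hE2 6 5 (by norm_num)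
  rw [hE] at hUP_6_5
  norm_num at hUP_6_5
  have hUP_7_3 := up_instance_lines hpairs hlines hE2 7 3 (by norm_num)
  rw [hE] at hUP_7_3
  norm_num at hUP_7_3
  have hUP_7_4 := up_instance_lines hpairs hlines hE2 7 4 (by norm_num)
  rw [hE] at hUP_7_4
  norm_num at hUP_7_4
  have hUP_7_5 := up_instance_lines hpairs hlines hE2 7 5 (by norm_num)
  rw [hE] at hUP_7_5
  norm_num at hUP_7_5
  have hUP_7_6 := up_instance hpairs hE2 7 6 (by norm_num)
  rw [hE] at hUP_7_6
  norm_num at hUP_7_6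
  have hCL_7_7 := cl_instance hM hcol hpairs hE2 7 7 (by norm_num) (by norm_num)
  rw [hE] at hCL_7_7
  norm_num at hCL_7_7
  have hUP_8_3 := up_instance_lines hpairs hlines hE2 8 3 (by norm_num)
  rw [hE] at hUP_8_3
  norm_num at hUP_8_3
  have hUP_8_4 := up_instance_lines hpairs hlines hE2 8 4 (by norm_num)
  rw [hE] at hUP_8_4
  norm_num at hUP_8_4
  have hUP_8_5 := up_instance_lines hpairs hlines hE2 8 5 (by norm_num)
  rw [hE] at hUP_8_5
  norm_num at hUP_8_5
  have hUP_8_6 := up_instance_lines hpairs hlines hE2 8 6 (by norm_num)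
  rw [hE] at hUP_8_6
  norm_num at hUP_8_6
  have hUP_8_7 := up_instance hpairs hE2 8 7 (by norm_num)
  rw [hE] at hUP_8_7
  norm_num at hUP_8_7
  have hUP_9_4 := up_instance_lines hpairs hlines hE2 9 4 (by norm_num)
  rw [hE] at hUP_9_4
  norm_num at hUP_9_4
  have hUP_9_5 := up_instance_lines hpairs hlines hE2 9 5 (by norm_num)
  rw [hE] at hUP_9_5
  norm_num at hUP_9_5
  have hUP_9_6 := up_instance_lines hpairs hlines hE2 9 6 (by norm_num)
  rw [hE] at hUP_9_6
  norm_num at hUP_9_6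
  have hUP_9_7 := up_instance_lines hpairs hlines hE2 9 7 (by norm_num)
  rw [hE] at hUP_9_7
  norm_num at hUP_9_7
  have hCL_9_8 := cl_instance_lines hM hcol hpairs hlines hE2 9 8 (by norm_num) (by norm_num)
  rw [hE] at hCL_9_8
  norm_num at hCL_9_8
  have hUP_10_5 := up_instance_lines hpairs hlines hE2 10 5 (by norm_num)
  rw [hE] at hUP_10_5
  norm_num at hUP_10_5
  have hUP_10_6 := up_instance_lines hpairs hlines hE2 10 6 (by norm_num)
  rw [hE] at hUP_10_6
  norm_num at hUP_10_6
  have hUP_10_7 := up_instance_lines hpairs hlines hE2 10 7 (by norm_num)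
  rw [hE] at hUP_10_7
  norm_num at hUP_10_7
  have hCL_10_8 := cl_instance_lines hM hcol hpairs hlines hE2 10 8 (by norm_num) (by norm_num)
  rw [hE] at hCL_10_8
  norm_num at hCL_10_8
  have hUP_11_6 := up_instance_lines hpairs hlines hE2 11 6 (by norm_num)
  rw [hE] at hUP_11_6
  norm_num at hUP_11_6
  have hUP_11_7 := up_instance_lines hpairs hlines hE2 11 7 (by norm_num)
  rw [hE] at hUP_11_7
  norm_num at hUP_11_7
  have hCL_11_8 := cl_instance_lines hM hcol hpairs hlines hE2 11 8 (by norm_num) (by norm_num)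
  rw [hE] at hCL_11_8
  norm_num at hCL_11_8
  have hUP_12_7 := up_instance_lines hpairs hlines hE2 12 7 (by norm_num)
  rw [hE] at hUP_12_7
  norm_num at hUP_12_7
  have hCL_12_8 := cl_instance_lines hM hcol hpairs hlines hE2 12 8 (by norm_num) (by norm_num)
  rw [hE] at hCL_12_8
  norm_num at hCL_12_8
  -- to `ℚ`
  qify at hU hL hY5 hY6 hY7 hY8 hP5 hP6 hP7 hP8 hz_2_3 hz_2_4 hz_2_5 hz_2_6 hz_2_7 hz_2_8 hz_2_9 hz_3_4 hz_3_5 hz_3_6 hz_3_7 hz_3_8 hz_3_9 hz_4_2 hz_4_5 hz_4_6 hz_4_7 hz_4_8 hz_4_9 hz_5_2 hz_5_6 hz_5_7 hz_5_8 hz_5_9 hz_6_2 hz_6_7 hz_6_8 hz_6_9 hz_7_2 hz_7_8 hz_7_9 hz_8_2 hz_8_9 hz_9_2 hz_9_3 hz_10_2 hz_10_3 hz_10_4 hz_11_2 hz_11_3 hz_11_4 hz_11_5 hz_12_2 hz_12_3 hz_12_4 hz_12_5 hz_12_6 hz_13_2 hz_13_3 hz_13_4 hz_13_5 hz_13_6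 hz_13_7 hz_14_2 hz_14_3 hz_14_4 hz_14_5 hz_14_6 hz_14_7 hz_14_8 hz_15_2 hz_15_3 hz_15_4 hz_15_5 hz_15_6 hz_15_7 hz_15_8 hUP_5_3 hUP_5_4 hUP_6_3 hUP_6_4 hUP_6_5 hUP_7_3 hUP_7_4 hUP_7_5 hUP_7_6 hUP_8_3 hUP_8_4 hUP_8_5 hUP_8_6 hUP_8_7 hUP_9_4 hUP_9_5 hUP_9_6 hUP_9_7 hUP_10_5 hUP_10_6 hUP_10_7 hUP_11_6 hUP_11_7 hUP_12_7 hCL_7_7 hCL_9_8 hCL_10_8 hCL_11_8 hCL_12_8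
  unfold ThmN.RLS
  rw [phiK_nine_four, hY]
  push_cast
  linarith

end S1

end PercRepro
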